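import Summits.HubbardSuperconductivity.HubbardSuperconductivity.Theorems.BalabanIRBirComplexStableXYRCoulombSandwich
import HarnessLib

/-!
# Crux `BirComplexStableXYR` (stmt-HubbardSuperconductivity-14845), line `fat-gaussian-defect-calculus`, chapter 2
# §2.1: structure of the Coulomb strain map `a ↦ σ_a` — uniqueness and additivity

Support file (prover seat 1, route BalabanIR; item G2 "Coulomb strain σ_a", structural part).

Lead c7's representation `FSUnfolding.stub_fsRepresentation` produces the strain EXISTENTIALLY: a map `σ` on the
tree-gauge (comb-vanishing) integer `1`-cochains with (i) `σ a = 2πa − d₀ψ_a` for some `ψ_a` and (ii) the Pythagorean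
identity `𝒬(d₀u − σ a) = 𝒬(d₀u) + 𝒬(σ a)` for all `u` (`𝒬(ω) = Σ_s Q(P_s ω)` the thin form).  Every later use of the
sector series (the `(q,h)`-labelling, the holonomy theta series of the line card §2.1, the Berry phase `e^{iKℓ(σ_a)}` of
stub D1) needs to know that these two properties DETERMINE `σ` and make it additive.  This file proves, for a table with
`Σ c_n = 0` and coercivity (C) at range `r ≥ 2`:

* `sss_pyth_iff_orth` — Pythagoras ⇔ `𝒬`-orthogonality to the gradients, `B(d₀u, σ) = 0` (`B` the polar form of
  `FSUnfolding.stub_thinFormPolar`);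
* `sss_strain_unique` — two strains of the same class both satisfying Pythagoras are EQUAL (their difference is a
  gradient of zero thin-form energy, hence zero by `FSUnfolding.stub_thinFormCoercive`);
* `sss_pyth_add`, `sss_pyth_neg`, `sss_pyth_zero` — Pythagoras is preserved under sums and negation;
* **`stub_strainAdditive`** (registered stub): ANY strain map with (i),(ii) on the comb-vanishing cochains is additive,
  `σ(a + b) = σ a + σ b`, odd, and vanishes at `0`;
* consequence (next file, `…HolonomyTheta`): on the pure holonomy sectors `a = seam h`, `h ∈ ℤ³`, the Gaussian cost
  `𝒬(σ(seam h))` is a quadratic form `hᵀSh` and every additive functional of the strain (the Berry phase of stub D1)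
  is linear in `h` — the vortex-free part of the sector series is a tilted three-dimensional theta series.

No definitions; sorry-free. [folklore: Fröhlich–Spencer, CMP 81 (1981) §3 (spin waves ⊥ vortices ⊥ fluxes)]
-/

noncomputable section

namespace Summit.HubbardSuperconductivity.HubbardSuperconductivity.Theorems

set_option linter.dupNamespace false -- summit = problem name (single-conjunct summit), D-0017

open scoped BigOperators ComplexConjugate
open Complex Summit.HubbardSuperconductivity.BirComplexStableXYNegative
open Literature.Probability.LatticeModels Literature.MathematicalPhysics.QuantumFieldTheory

section SectorStrainStructure

variable {r : ℕ} {L M : ℕ} [NeZero L] [NeZero M]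

/-- **Pythagoras ⇔ orthogonality.**  For a symmetric bilinear form `B` with diagonal `𝒬`, a cochain `σ` satisfies
`𝒬(d₀u − σ) = 𝒬(d₀u) + 𝒬(σ)` for all `u` iff `B(d₀u, σ) = 0` for all `u`. [folklore] -/
theorem sss_pyth_iff_orth (B : (Λ L M → Fin 3 → ℝ) →ₗ[ℝ] (Λ L M → Fin 3 → ℝ) →ₗ[ℝ] ℝ)
    (hBsymm : ∀ ω ω' : Λ L M → Fin 3 → ℝ, B ω ω' = B ω' ω) (𝒬 : (Λ L M → Fin 3 → ℝ) → ℝ)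
    (hBdiag : ∀ ω : Λ L M → Fin 3 → ℝ, B ω ω = 𝒬 ω) (σ : Λ L M → Fin 3 → ℝ) :
    (∀ u : Λ L M → ℝ, 𝒬 (fun x i => (TorusChart.piProdZMod 2 L M).d₀ u x i - σ x i)
        = 𝒬 ((TorusChart.piProdZMod 2 L M).d₀ u) + 𝒬 σ) ↔
      ∀ u : Λ L M → ℝ, B ((TorusChart.piProdZMod 2 L M).d₀ u) σ = 0 := by
  set F := TorusChart.piProdZMod 2 L M with hF
  have hexp : ∀ u : Λ L M → ℝ, 𝒬 (fun x i => F.d₀ u x i - σ x i) = 𝒬 (F.d₀ u) + 𝒬 σ - 2 * B (F.d₀ u) σ := by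
    intro u
    have hfun : (fun x i => F.d₀ u x i - σ x i) = F.d₀ u - σ := rfl
    rw [hfun, ← hBdiag, ← hBdiag, ← hBdiag]
    simp only [map_sub, LinearMap.sub_apply]
    rw [hBsymm σ (F.d₀ u)]
    ring
  constructor
  · intro h u
    have := h u
    rw [hexp u] at this
    linarith
  · intro h u
    rw [hexp u, h u]
    ring

/-- **Evenness of Pythagoras in the gradient**: if `σ` satisfies Pythagoras then also
`𝒬(d₀u + σ) = 𝒬(d₀u) + 𝒬(σ)`, by `𝒬(−η) = 𝒬(η)`. [folklore] -/
theorem sss_pyth_add_form (c : Table r) (P : (Λ L M → Fin 3 → ℝ) → Λ L M → W r → ℝ)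
    (hP : ∀ (ω : Λ L M → Fin 3 → ℝ) (s : Λ L M) (w : W r), P ω s w =
      (TorusChart.piProdZMod 2 L M).lineSum ω 0 (w.1 : ℕ) s
        + (TorusChart.piProdZMod 2 L M).lineSum ω 1 (w.2.1 : ℕ) (s + (w.1 : ℕ) • (TorusChart.piProdZMod 2 L M).gen 0)
        + (TorusChart.piProdZMod 2 L M).lineSum ω 2 (w.2.2 : ℕ)
          (s + (w.1 : ℕ) • (TorusChart.piProdZMod 2 L M).gen 0 + (w.2.1 : ℕ) • (TorusChart.piProdZMod 2 L M).gen 1))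
    (Q : (W r → ℝ) → ℝ) (hQ : ∀ u : W r → ℝ, Q u = (-c.sum (fun n a => a * (((∑ w, (n w : ℝ) * u w) ^ 2 : ℝ) : ℂ))).re)
    (σ : Λ L M → Fin 3 → ℝ)
    (hpy : ∀ u : Λ L M → ℝ, ∑ s : Λ L M, Q (P (fun x i => (TorusChart.piProdZMod 2 L M).d₀ u x i - σ x i) s)
      = ∑ s : Λ L M, Q (P ((TorusChart.piProdZMod 2 L M).d₀ u) s) + ∑ s : Λ L M, Q (P σ s))
    (u : Λ L M → ℝ) :
    ∑ s : Λ L M, Q (P (fun x i => (TorusChart.piProdZMod 2 L M).d₀ u x i + σ x i) s)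
      = ∑ s : Λ L M, Q (P ((TorusChart.piProdZMod 2 L M).d₀ u) s) + ∑ s : Λ L M, Q (P σ s) := by
  set F := TorusChart.piProdZMod 2 L M with hF
  have hid : (fun x i => F.d₀ u x i + σ x i) = -(fun x i => F.d₀ (-u) x i - σ x i) := by
    funext x i
    simp only [Pi.neg_apply, TorusChart.d₀_neg]
    ring
  have hneg : (F.d₀ (-u)) = -(F.d₀ u) := TorusChart.d₀_neg F u
  rw [hid, csw_thinForm_even c P hP Q hQ, hpy (-u), hneg, csw_thinForm_even c P hP Q hQ]

/-- **Uniqueness of the strain.**  If two real cochains `σ, σ'` differ by a gradient (`σ = σ' + d₀v`, e.g. both lie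
in the class `ω + d₀(·)`) and both satisfy Pythagoras, then `σ = σ'`: the gradient `d₀v` has zero thin-form energy,
hence vanishes by coercivity (`stub_thinFormCoercive`). [folklore] -/
theorem sss_strain_unique (c : Table r) {c₀ : ℝ} (hr : 2 ≤ r) (hc₀ : 0 < c₀)
    (hA : c.sum (fun _ a => a) = 0)
    (hC : ∀ φ : W r → ℝ, c₀ * ∑ w, ∑ w', (1 - Real.cos (φ w - φ w')) ≤ (genF c φ).re)
    (P : (Λ L M → Fin 3 → ℝ) → Λ L M → W r → ℝ)
    (hP : ∀ (ω : Λ L M → Fin 3 → ℝ) (s : Λ L M) (w : W r), P ω s w =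
      (TorusChart.piProdZMod 2 L M).lineSum ω 0 (w.1 : ℕ) s
        + (TorusChart.piProdZMod 2 L M).lineSum ω 1 (w.2.1 : ℕ) (s + (w.1 : ℕ) • (TorusChart.piProdZMod 2 L M).gen 0)
        + (TorusChart.piProdZMod 2 L M).lineSum ω 2 (w.2.2 : ℕ)
          (s + (w.1 : ℕ) • (TorusChart.piProdZMod 2 L M).gen 0 + (w.2.1 : ℕ) • (TorusChart.piProdZMod 2 L M).gen 1))
    (Q : (W r → ℝ) → ℝ) (hQ : ∀ u : W r → ℝ, Q u = (-c.sum (fun n a => a * (((∑ w, (n w : ℝ) * u w) ^ 2 : ℝ) : ℂ))).re)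
    (σ σ' : Λ L M → Fin 3 → ℝ) (v : Λ L M → ℝ)
    (hdiff : σ = fun x i => σ' x i + (TorusChart.piProdZMod 2 L M).d₀ v x i)
    (hpy : ∀ u : Λ L M → ℝ, ∑ s : Λ L M, Q (P (fun x i => (TorusChart.piProdZMod 2 L M).d₀ u x i - σ x i) s)
      = ∑ s : Λ L M, Q (P ((TorusChart.piProdZMod 2 L M).d₀ u) s) + ∑ s : Λ L M, Q (P σ s))
    (hpy' : ∀ u : Λ L M → ℝ, ∑ s : Λ L M, Q (P (fun x i => (TorusChart.piProdZMod 2 L M).d₀ u x i - σ' x i) s)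
      = ∑ s : Λ L M, Q (P ((TorusChart.piProdZMod 2 L M).d₀ u) s) + ∑ s : Λ L M, Q (P σ' s)) :
    σ = σ' := by
  set F := TorusChart.piProdZMod 2 L M with hF
  -- Pythagoras for `σ` at `u = v`: `d₀v − σ = −σ'`
  have h1 : (fun x i => F.d₀ v x i - σ x i) = -σ' := by
    funext x i; simp only [hdiff, Pi.neg_apply]; ring
  have e1 := hpy v
  rw [h1, csw_thinForm_even c P hP Q hQ] at e1
  -- Pythagoras for `σ'` in the `+` form at `u = v`: `d₀v + σ' = σ`
  have h2 : (fun x i => F.d₀ v x i + σ' x i) = σ := by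
    funext x i; simp only [hdiff]; ring
  have e2 := sss_pyth_add_form c P hP Q hQ σ' hpy' v
  rw [h2] at e2
  -- hence `𝒬(d₀ v) = 0`, so `d₀ v = 0` by coercivity
  have hzero : ∑ s : Λ L M, Q (P (F.d₀ v) s) = 0 := by linarith
  have hcoer := FSUnfolding.stub_thinFormCoercive r c c₀ hr hc₀ hA hC L M (F.d₀ v)
  have hQP : ∀ s : Λ L M, Q (P (F.d₀ v) s)
      = (-c.sum (fun n a => a * (((∑ w : W r, (n w : ℝ) *
          (F.lineSum (F.d₀ v) 0 (w.1 : ℕ) s + F.lineSum (F.d₀ v) 1 (w.2.1 : ℕ) (s + (w.1 : ℕ) • F.gen 0)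
            + F.lineSum (F.d₀ v) 2 (w.2.2 : ℕ) (s + (w.1 : ℕ) • F.gen 0 + (w.2.1 : ℕ) • F.gen 1))) ^ 2 : ℝ) : ℂ))).re := by
    intro s; rw [hQ]; simp only [hP]
  rw [← Finset.sum_congr rfl fun s _ => hQP s, hzero] at hcoer
  have hsq : ∑ x : Λ L M, ∑ i : Fin 3, (F.d₀ v x i) ^ 2 = 0 := by
    have hnn : 0 ≤ ∑ x : Λ L M, ∑ i : Fin 3, (F.d₀ v x i) ^ 2 :=
      Finset.sum_nonneg fun x _ => Finset.sum_nonneg fun i _ => sq_nonneg _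
    have h2c : 0 < 2 * c₀ := by positivity
    nlinarith
  have hpt : ∀ x i, F.d₀ v x i = 0 := by
    intro x i
    have hx : ∑ j : Fin 3, (F.d₀ v x j) ^ 2 = 0 := by
      refine (Finset.sum_eq_zero_iff_of_nonneg fun y _ => Finset.sum_nonneg fun j _ => sq_nonneg _).1 hsq x
        (Finset.mem_univ x)
    have := (Finset.sum_eq_zero_iff_of_nonneg fun j _ => sq_nonneg (F.d₀ v x j)).1 hx i (Finset.mem_univ i)
    exact pow_eq_zero_iff (n := 2) (by norm_num) |>.1 this
  funext x i
  rw [hdiff]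
  simp only [hpt x i, add_zero]

/-- **Pythagoras is preserved under negation.** [folklore] -/
theorem sss_pyth_neg (c : Table r) (P : (Λ L M → Fin 3 → ℝ) → Λ L M → W r → ℝ)
    (hP : ∀ (ω : Λ L M → Fin 3 → ℝ) (s : Λ L M) (w : W r), P ω s w =
      (TorusChart.piProdZMod 2 L M).lineSum ω 0 (w.1 : ℕ) s
        + (TorusChart.piProdZMod 2 L M).lineSum ω 1 (w.2.1 : ℕ) (s + (w.1 : ℕ) • (TorusChart.piProdZMod 2 L M).gen 0)
        + (TorusChart.piProdZMod 2 L M).lineSum ω 2 (w.2.2 : ℕ)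
          (s + (w.1 : ℕ) • (TorusChart.piProdZMod 2 L M).gen 0 + (w.2.1 : ℕ) • (TorusChart.piProdZMod 2 L M).gen 1))
    (Q : (W r → ℝ) → ℝ) (hQ : ∀ u : W r → ℝ, Q u = (-c.sum (fun n a => a * (((∑ w, (n w : ℝ) * u w) ^ 2 : ℝ) : ℂ))).re)
    (σ : Λ L M → Fin 3 → ℝ)
    (hpy : ∀ u : Λ L M → ℝ, ∑ s : Λ L M, Q (P (fun x i => (TorusChart.piProdZMod 2 L M).d₀ u x i - σ x i) s)
      = ∑ s : Λ L M, Q (P ((TorusChart.piProdZMod 2 L M).d₀ u) s) + ∑ s : Λ L M, Q (P σ s))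
    (u : Λ L M → ℝ) :
    ∑ s : Λ L M, Q (P (fun x i => (TorusChart.piProdZMod 2 L M).d₀ u x i - (-σ) x i) s)
      = ∑ s : Λ L M, Q (P ((TorusChart.piProdZMod 2 L M).d₀ u) s) + ∑ s : Λ L M, Q (P (-σ) s) := by
  have hid : (fun x i => (TorusChart.piProdZMod 2 L M).d₀ u x i - (-σ) x i)
      = fun x i => (TorusChart.piProdZMod 2 L M).d₀ u x i + σ x i := by
    funext x i; simp only [Pi.neg_apply]; ring
  rw [hid, sss_pyth_add_form c P hP Q hQ σ hpy u, csw_thinForm_even c P hP Q hQ]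

/-- **Pythagoras is preserved under sums** (orthogonality to the gradients is linear in `σ`). [folklore] -/
theorem sss_pyth_add (c : Table r) (P : (Λ L M → Fin 3 → ℝ) → Λ L M → W r → ℝ)
    (hP : ∀ (ω : Λ L M → Fin 3 → ℝ) (s : Λ L M) (w : W r), P ω s w =
      (TorusChart.piProdZMod 2 L M).lineSum ω 0 (w.1 : ℕ) s
        + (TorusChart.piProdZMod 2 L M).lineSum ω 1 (w.2.1 : ℕ) (s + (w.1 : ℕ) • (TorusChart.piProdZMod 2 L M).gen 0)
        + (TorusChart.piProdZMod 2 L M).lineSum ω 2 (w.2.2 : ℕ)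
          (s + (w.1 : ℕ) • (TorusChart.piProdZMod 2 L M).gen 0 + (w.2.1 : ℕ) • (TorusChart.piProdZMod 2 L M).gen 1))
    (Q : (W r → ℝ) → ℝ) (hQ : ∀ u : W r → ℝ, Q u = (-c.sum (fun n a => a * (((∑ w, (n w : ℝ) * u w) ^ 2 : ℝ) : ℂ))).re)
    (σ₁ σ₂ : Λ L M → Fin 3 → ℝ)
    (hpy₁ : ∀ u : Λ L M → ℝ, ∑ s : Λ L M, Q (P (fun x i => (TorusChart.piProdZMod 2 L M).d₀ u x i - σ₁ x i) s)
      = ∑ s : Λ L M, Q (P ((TorusChart.piProdZMod 2 L M).d₀ u) s) + ∑ s : Λ L M, Q (P σ₁ s))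
    (hpy₂ : ∀ u : Λ L M → ℝ, ∑ s : Λ L M, Q (P (fun x i => (TorusChart.piProdZMod 2 L M).d₀ u x i - σ₂ x i) s)
      = ∑ s : Λ L M, Q (P ((TorusChart.piProdZMod 2 L M).d₀ u) s) + ∑ s : Λ L M, Q (P σ₂ s))
    (u : Λ L M → ℝ) :
    ∑ s : Λ L M, Q (P (fun x i => (TorusChart.piProdZMod 2 L M).d₀ u x i - (σ₁ + σ₂) x i) s)
      = ∑ s : Λ L M, Q (P ((TorusChart.piProdZMod 2 L M).d₀ u) s) + ∑ s : Λ L M, Q (P (σ₁ + σ₂) s) := by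
  obtain ⟨B, hBsymm, hBdiag⟩ := FSUnfolding.stub_thinFormPolar r c L M P hP Q hQ
  have h₁ := (sss_pyth_iff_orth B hBsymm (fun ω => ∑ s : Λ L M, Q (P ω s)) hBdiag σ₁).1 hpy₁
  have h₂ := (sss_pyth_iff_orth B hBsymm (fun ω => ∑ s : Λ L M, Q (P ω s)) hBdiag σ₂).1 hpy₂
  refine (sss_pyth_iff_orth B hBsymm (fun ω => ∑ s : Λ L M, Q (P ω s)) hBdiag (σ₁ + σ₂)).2 (fun u => ?_) u
  rw [map_add, h₁ u, h₂ u, add_zero]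

/-- **The zero cochain satisfies Pythagoras** (trivially). [folklore] -/
theorem sss_pyth_zero (c : Table r) (L M : ℕ) [NeZero L] [NeZero M] (P : (Λ L M → Fin 3 → ℝ) → Λ L M → W r → ℝ)
    (hP : ∀ (ω : Λ L M → Fin 3 → ℝ) (s : Λ L M) (w : W r), P ω s w =
      (TorusChart.piProdZMod 2 L M).lineSum ω 0 (w.1 : ℕ) s
        + (TorusChart.piProdZMod 2 L M).lineSum ω 1 (w.2.1 : ℕ) (s + (w.1 : ℕ) • (TorusChart.piProdZMod 2 L M).gen 0)
        + (TorusChart.piProdZMod 2 L M).lineSum ω 2 (w.2.2 : ℕ)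
          (s + (w.1 : ℕ) • (TorusChart.piProdZMod 2 L M).gen 0 + (w.2.1 : ℕ) • (TorusChart.piProdZMod 2 L M).gen 1))
    (Q : (W r → ℝ) → ℝ) (hQ : ∀ u : W r → ℝ, Q u = (-c.sum (fun n a => a * (((∑ w, (n w : ℝ) * u w) ^ 2 : ℝ) : ℂ))).re)
    (u : Λ L M → ℝ) :
    ∑ s : Λ L M, Q (P (fun x i => (TorusChart.piProdZMod 2 L M).d₀ u x i - (0 : Λ L M → Fin 3 → ℝ) x i) s)
      = ∑ s : Λ L M, Q (P ((TorusChart.piProdZMod 2 L M).d₀ u) s) + ∑ s : Λ L M, Q (P (0 : Λ L M → Fin 3 → ℝ) s) := by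
  obtain ⟨B, _, hBdiag⟩ := FSUnfolding.stub_thinFormPolar r c L M P hP Q hQ
  have h0 : ∑ s : Λ L M, Q (P (0 : Λ L M → Fin 3 → ℝ) s) = 0 := by
    rw [← hBdiag]; simp
  have hid : (fun x i => (TorusChart.piProdZMod 2 L M).d₀ u x i - (0 : Λ L M → Fin 3 → ℝ) x i)
      = (TorusChart.piProdZMod 2 L M).d₀ u := by
    funext x i; simp
  rw [hid, h0, add_zero]

/-- **Registered stub `stub_strainAdditive` (prover seat 1 on stmt-HubbardSuperconductivity-14845; chapter 2 §2.1):
the strain map of the Fröhlich–Spencer representation is additive.**  For a table with `Σ c_n = 0` and coercivity (C)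
at range `r ≥ 2`, ANY map `σ` on the tree-gauge (comb-vanishing) integer `1`-cochains of `Λ L M` with the two
properties recorded in `FSUnfolding.stub_fsRepresentation` — `σ a = 2πa − d₀ψ_a` for some `ψ_a`, and Pythagoras
`𝒬(d₀u − σ a) = 𝒬(d₀u) + 𝒬(σ a)` for all `u` — satisfies `σ(a + b) = σ a + σ b`, `σ(−a) = −σ a` and `σ 0 = 0`
(the comb-vanishing cochains form a subgroup; uniqueness `sss_strain_unique` + `sss_pyth_add` / `sss_pyth_neg`).
[folklore] -/
theorem stub_strainAdditive : ∀ (r : ℕ) (c : Table r) (c₀ : ℝ), 2 ≤ r → 0 < c₀ → c.sum (fun _ a => a) = 0 → (∀ φ : W r → ℝ, c₀ * ∑ w, ∑ w', (1 - Real.cos (φ w - φ w')) ≤ (genF c φ).re) → ∀ (L M : ℕ) [NeZero L] [NeZero M] (P : (Λ L M → Fin 3 → ℝ) → Λ L M → W r → ℝ), (∀ (ω : Λ L M → Fin 3 → ℝ) (s : Λ L M) (w : W r), P ω s w = (Literature.MathematicalPhysics.QuantumFieldTheory.TorusChart.piProdZMod 2 L M).lineSum ω 0 (w.1 : ℕ)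 s + (Literature.MathematicalPhysics.QuantumFieldTheory.TorusChart.piProdZMod 2 L M).lineSum ω 1 (w.2.1 : ℕ) (s + (w.1 : ℕ) • (Literature.MathematicalPhysics.QuantumFieldTheory.TorusChart.piProdZMod 2 L M).gen 0) + (Literature.MathematicalPhysics.QuantumFieldTheory.TorusChart.piProdZMod 2 L M).lineSum ω 2 (w.2.2 : ℕ) (s + (w.1 : ℕ) • (Literature.MathematicalPhysics.QuantumFieldTheory.TorusChart.piProdZMod 2 L M).gen 0 + (w.2.1 : ℕ) • (Literature.MathematicalPhysics.QuantumFieldTheory.TorusChart.piProdZMod 2 L M).gen 1)) → ∀ (Q : (W r → ℝ) → ℝ), (∀ u : W r → ℝ, Q u = (-c.sum (fun n a => a * (((∑ w, (n w : ℝ) * u w) ^ 2 : ℝ) : ℂ))).re) → ∀ (σ : {a : Λ L M → Fin 3 → ℤ // ∀ (y : Λ L M) (μ : Fin 3), (∀ ν : Fin 3, μ < ν → (Literature.MathematicalPhysics.QuantumFieldTheory.TorusChart.piProdZMod 2 L M).cval ν y = 0) → (Literature.MathematicalPhysics.QuantumFieldTheory.TorusChart.piProdZMod 2 L M).cval μ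 y + 1 < (Literature.MathematicalPhysics.QuantumFieldTheory.TorusChart.piProdZMod 2 L M).period μ → a y μ = 0} → (Λ L M → Fin 3 → ℝ)), (∀ a, ∃ ψ : Λ L M → ℝ, σ a = fun x i => 2 * Real.pi * (a.1 x i : ℝ) - (Literature.MathematicalPhysics.QuantumFieldTheory.TorusChart.piProdZMod 2 L M).d₀ ψ x i) → (∀ a (u : Λ L M → ℝ), ∑ s : Λ L M, Q (P (fun x i => (Literature.MathematicalPhysics.QuantumFieldTheory.TorusChart.piProdZMod 2 L M).d₀ u x i - σ a x i) s) = ∑ s : Λ L M, Q (P ((Literature.MathematicalPhysics.QuantumFieldTheory.TorusChart.piProdZMod 2 L M).d₀ u) s) + ∑ s : Λ L M, Q (P (σ a) s)) → (∀ (a b : {a : Λ L M → Fin 3 → ℤ // ∀ (y : Λ L M) (μ : Fin 3), (∀ ν : Fin 3, μ < ν → (Literature.MathematicalPhysics.QuantumFieldTheory.TorusChart.piProdZMod 2 L M).cval ν y = 0) → (Literature.MathematicalPhysics.QuantumFieldTheory.TorusChart.piProdZMod 2 L M).cval μ y + 1 < (Literature.MathematicalPhysics.QuantumFieldTheory.TorusChart.piProdZMod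 2 L M).period μ → a y μ = 0}), σ ⟨a.1 + b.1, fun y μ hν hμ => by rw [Pi.add_apply, Pi.add_apply, a.2 y μ hν hμ, b.2 y μ hν hμ, add_zero]⟩ = σ a + σ b) ∧ (∀ (a : {a : Λ L M → Fin 3 → ℤ // ∀ (y : Λ L M) (μ : Fin 3), (∀ ν : Fin 3, μ < ν → (Literature.MathematicalPhysics.QuantumFieldTheory.TorusChart.piProdZMod 2 L M).cval ν y = 0) → (Literature.MathematicalPhysics.QuantumFieldTheory.TorusChart.piProdZMod 2 L M).cval μ y + 1 < (Literature.MathematicalPhysics.QuantumFieldTheory.TorusChart.piProdZMod 2 L M).period μ → a y μ = 0}), σ ⟨-a.1, fun y μ hν hμ => by rw [Pi.neg_apply, Pi.neg_apply, a.2 y μ hν hμ, neg_zero]⟩ = -σ a) ∧ σ ⟨0, fun _ _ _ _ => rfl⟩ = 0 := by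
  intro r c c₀ hr hc₀ hA hC L M _ _ P hP Q hQ σ hcls hpy
  refine ⟨fun a b => ?_, fun a => ?_, ?_⟩
  · -- additivity: both sides are strains of the class of `2π(a+b)` satisfying Pythagoras
    obtain ⟨ψab, hab⟩ := hcls ⟨a.1 + b.1, fun y μ hν hμ => by
      rw [Pi.add_apply, Pi.add_apply, a.2 y μ hν hμ, b.2 y μ hν hμ, add_zero]⟩
    obtain ⟨ψa, ha⟩ := hcls a
    obtain ⟨ψb, hb⟩ := hcls b
    refine sss_strain_unique c hr hc₀ hA hC P hP Q hQ _ (σ a + σ b) (fun x => ψa x + ψb x - ψab x) ?_ (hpy _) ?_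
    · rw [hab]
      funext x i
      rw [Pi.add_apply, Pi.add_apply, ha, hb]
      simp only [TorusChart.d₀_apply, Pi.add_apply, Int.cast_add]
      ring
    · exact sss_pyth_add c P hP Q hQ (σ a) (σ b) (hpy a) (hpy b)
  · -- oddness
    obtain ⟨ψn, hn⟩ := hcls ⟨-a.1, fun y μ hν hμ => by rw [Pi.neg_apply, Pi.neg_apply, a.2 y μ hν hμ, neg_zero]⟩
    obtain ⟨ψa, ha⟩ := hcls a
    refine sss_strain_unique c hr hc₀ hA hC P hP Q hQ _ (-σ a) (fun x => -ψa x - ψn x) ?_ (hpy _) ?_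
    · rw [hn]
      funext x i
      rw [Pi.neg_apply, Pi.neg_apply, ha]
      simp only [TorusChart.d₀_apply, Pi.neg_apply, Int.cast_neg]
      ring
    · exact sss_pyth_neg c P hP Q hQ (σ a) (hpy a)
  · -- value at zero
    obtain ⟨ψ0, h0⟩ := hcls ⟨0, fun _ _ _ _ => rfl⟩
    refine sss_strain_unique c hr hc₀ hA hC P hP Q hQ _ 0 (fun x => -ψ0 x) ?_ (hpy _) (sss_pyth_zero c L M P hP Q hQ)
    rw [h0]
    funext x i
    simp only [TorusChart.d₀_apply, Pi.zero_apply, Int.cast_zero]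
    ring

end SectorStrainStructure

end Summit.HubbardSuperconductivity.HubbardSuperconductivity.Theorems

end
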